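import Literature.NumberTheory.GelbartRogawski1991.QuadExtSplittingCharArchType
import Literature.NumberTheory.GelbartRogawski1991.DoubledUnitaryArchSiegelTwist
import HarnessLib

/-!
# The `det`-power twist at the `c`-fixed (type (i)) archimedean places of a global splitting character of an ARBITRARY
# quadratic `E/F`: `η(g)² · ∏_v det(g_{w(v)})⁻¹ = ∏_v χ_{w(v)}(u_{w(v)})²`

Topic `NumberTheory/GelbartRogawski1991`; namespace `Literature.NumberTheory.GelbartRogawski1991.UnitaryDualPair.ArchSplitting.QuadExt`.
KERNEL only: proved theorems; no definition, no named fact, no `sorry`.  The general-`E/F` twin of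
`CMSplittingCharArchComponents` §4 (`IsSplittingChar.exists_archDetTwist`, CM fields): there the odd archimedean type came from the
CM arch-type theory and the identity was stated against `χ((x,1))²` over ALL infinite places (all of type (i) for a CM field); here

* the places are a chosen family `wOf : {v real place of F} → {w complex place of E}` of `c`-FIXED places over (some or all of) the real
  places of `F` (`hw : c • wOf v = wOf v`, `hover : wOf v ∣ v`) — for `E` totally complex and `F` arbitrary these are exactly the
  places of type (i), the complex places of `F` (type (iii)) being treated separately
  (`QuadExtSplittingCharArchComponents.IsSplittingCharExt.prod_archComponent_placesOver_of_isComplex`);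
* the odd exponents `e_v` come from `QuadExtSplittingCharArchType.IsSplittingCharExt.exists_odd_archComponent_eq_unitPart_zpow`
  (`χ_{w(v)}(y) = (σ y/|σ y|)^{e_v}`, no CM theory);
* the identity is stated against the PRODUCT OF THE SQUARES OF THE ARCHIMEDEAN COMPONENTS at the chosen places,
  `∏_v χ_{w(v)}(u_{w(v)})²`, for any idèle `u` of `E` (e.g. `u = det_Δ (g,1)`) whose components at the `w(v)` satisfy
  `σ(u_{w(v)})/σ(u_{w(v)})‾ = det g_{w(v)}` — to be multiplied by the consumer with the complex-place factors and compared with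
  `χ(u)² = ∏_w χ_w(u_w)²` (`QuadExt.apply_eq_prod_archComponent_of_snd_eq_one`, `prod_infinitePlace_eq_prod_placesOver`).

Main statement **`IsSplittingCharExt.exists_archDetTwist`**: for `χ` unitary with `χ|_{𝕀_F} = ε_{E/F}` there are odd integers
`e_v` and the continuous character `η = ∏_v det(g_{w(v)})^{(e_v+1)/2}` of `U(J)(E ⊗ ℝ)` (`exists_archDetZPow`, any `J`) with
`η(g)² · ∏_v det(g_{w(v)})⁻¹ = ∏_v χ_{w(v)}(u_{w(v)})²` under the compatibility above (`(d^k)² d⁻¹ = d^{2k-1} = d^{e}` and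
`χ_w(y)² = (σ y/σ y‾)^{e}`).  [Paul1998, §1.2 (1.2.1)–(1.2.2)]: the `det`-power characters of the `det^{1/2}`-covers of real unitary
groups; [Liu2021, Remark 4.2]: odd archimedean type.

§2 instantiates `u := det_Δ (g,1)` (Kudla's `x((g,1))`) for `g ∈ U(J^𝔻)(E ⊗ ℝ)` with `(g,1) ∈ P_Δ`, `J^𝔻 = e₂(T ⊕ −T)e₂ ⊗ E`,
`T ∈ GL_n(F)`: the compatibility `σ(u_{w(v)})/σ(u_{w(v)})‾ = det g_{w(v)}` is the general-`E/F` re-typing `det_archAt_mul_conj_eq` of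
the CM lemma of `DoubledUnitaryArchSiegelTwist` (unitarity of `g_w` + the Siegel relation, `AdaptedBlocks.det_mul_map_det_deltaBlock_reindex`),
whence **`IsSplittingCharExt.exists_archDetTwist_doubled`** — the general twin of `IsSplittingChar.exists_archDetTwist_doubled`
with right-hand side the type-(i) part `∏_v χ_{w(v)}(u_{w(v)})²` of `χ(u)²`.  Nothing here is a claim of the manuscripts adjudicated
by the Hodge-CM cell.

## References

* [Paul1998] A. Paul, J. Funct. Anal. 159 (1998), §1.2 (1.2.1)–(1.2.2) p. 389.
* [Liu2021] Y. Liu, Camb. J. Math. 9 (2021), §4.1 Remark 4.2.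
* [GelbartRogawski1991] S. Gelbart, J. Rogawski, Invent. Math. 105 (1991), §3.1 p. 456 (3.1.2), Remark p. 457.
-/

set_option autoImplicit false

noncomputable section

open scoped NumberField Classical ComplexConjugate MatrixGroups
open NumberField NumberField.InfinitePlace IsDedekindDomain

open _root_.Literature.NumberTheory.Automorphic _root_.Literature.NumberTheory.Automorphic.UnitaryGroup
open _root_.Literature.NumberTheory.GaloisRepresentations
open _root_.Literature.RepresentationTheory.HarrisKudlaSweet1996
open _root_.Literature.Analysis.Complex (unitPart coe_unitPart)
open _root_.Literature.NumberTheory.GelbartRogawski1991.AdaptedBlocks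

namespace Literature.NumberTheory.GelbartRogawski1991.UnitaryDualPair.ArchSplitting.QuadExt

variable (F E : Type) [Field F] [NumberField F] [Field E] [NumberField E] [Algebra F E] [Algebra.IsQuadraticExtension F E]
  (c : E ≃ₐ[F] E) {N : ℕ} (J : Matrix (Fin N) (Fin N) E) (hc : c ≠ 1) {δ : E} (hcδ : c δ = -δ) (hδ : δ ≠ 0)
  (wOf : {v : InfinitePlace F // v.IsReal} → {w : InfinitePlace E // w.IsComplex})
  (hw : ∀ v, c • (wOf v).1 = (wOf v).1)

/-- `(u^k)² · u⁻¹ = u^{2k−1}` for `u ≠ 0`. [folklore] -/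
private theorem zpow_sq_mul_inv' {u : ℂ} (hu : u ≠ 0) (k : ℤ) : (u ^ k) ^ 2 * u⁻¹ = u ^ (2 * k - 1) := by
  rw [zpow_sub_one₀ hu, two_mul, zpow_add₀ hu, sq]

/-- an odd integer `e` is `2k − 1` with `k = (e + 1)/2`. [folklore] -/
private theorem two_mul_add_one_ediv_two_sub_one' {e : ℤ} (he : Odd e) : 2 * ((e + 1) / 2) - 1 = e := by
  obtain ⟨m, rfl⟩ := he
  omega

omit [NumberField F] [NumberField E] [Algebra F E] [Algebra.IsQuadraticExtension F E] in
/-- `(σ y/|σ y|)^{e}`, squared, is `(σ y/σ y‾)^{e}`. [folklore] -/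
private theorem unitPart_zpow_sq (y : ℂˣ) (e : ℤ) :
    (((unitPart y : Circle) : ℂ) ^ e) ^ 2 = ((y : ℂ) / conj (y : ℂ)) ^ e := by
  rw [← zpow_natCast, ← zpow_mul, mul_comm, zpow_mul, zpow_natCast, coe_unitPart,
    HeckeCharacter.CMQuadraticExtension.div_norm_sq_eq_div_conj y.ne_zero]

include hc hcδ hδ hw in
/-- **THE `det`-POWER TWIST AT THE `c`-FIXED ARCHIMEDEAN PLACES** (general quadratic `E/F`).  Let `χ` be a UNITARY Hecke character of
`E` with `χ|_{𝕀_F} = ε_{E/F}`, and `v ↦ w(v)` a family of `c`-fixed complex places of `E` over real places of `F`.  Then there are ODD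
integers `e_v` with `χ_{w(v)}(y) = (σ_{w(v)} y/|σ_{w(v)} y|)^{e_v}` on `E_{w(v)}ˣ`, and the CONTINUOUS character
`η(g) = ∏_v det(g_{w(v)})^{(e_v+1)/2}` of `U(J)(E ⊗ ℝ)` (`g_w = archAt w g`), such that for every `g` and every idèle `u` of `E` with
`σ(u_{w(v)})/σ(u_{w(v)})‾ = det g_{w(v)}` at each `v`:
`η(g)² · ∏_v det(g_{w(v)})⁻¹ = ∏_v χ_{w(v)}(u_{w(v)})²` (both sides are `∏_v det(g_{w(v)})^{e_v}`).
[cite: Paul1998, §1.2 (1.2.1)–(1.2.2) p. 389 L11–29] [cite: Liu2021, Remark 4.2] -/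
theorem _root_.Literature.RepresentationTheory.HarrisKudlaSweet1996.IsSplittingCharExt.exists_archDetTwist
    {χ : HeckeCharacter E} (hχu : χ.IsUnitary) (hχ : IsSplittingCharExt F E 1 χ) :
    ∃ (e : {v : InfinitePlace F // v.IsReal} → ℤ) (η : arch F E c N J →* ℂˣ),
      (∀ v, Odd (e v)) ∧
      (∀ v (y : ((wOf v).1.Completion)ˣ), ((χ.archComponent (wOf v).1 y : ℂˣ) : ℂ) =
        ((unitPart (Units.map (Completion.extensionEmbedding (wOf v).1).toMonoidHom y) : Circle) : ℂ) ^ e v) ∧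
      (∀ g, ((η g : ℂˣ) : ℂ) =
        ∏ v : {v : InfinitePlace F // v.IsReal},
          (((archAt F E c N J (wOf v) (hw v) hc g : archLocal E N J (wOf v)) : GL (Fin N) ℂ) :
            Matrix (Fin N) (Fin N) ℂ).det ^ ((e v + 1) / 2)) ∧
      (Continuous fun g => ((η g : ℂˣ) : ℂ)) ∧
      ∀ (g : arch F E c N J) (u : ideleGroup E),
        (∀ v : {v : InfinitePlace F // v.IsReal},
          Completion.extensionEmbedding (wOf v).1 (((u : ideleGroup E) : AdeleRing (𝓞 E) E).1 (wOf v).1) /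
              conj (Completion.extensionEmbedding (wOf v).1 (((u : ideleGroup E) : AdeleRing (𝓞 E) E).1 (wOf v).1)) =
            (((archAt F E c N J (wOf v) (hw v) hc g : archLocal E N J (wOf v)) : GL (Fin N) ℂ) :
              Matrix (Fin N) (Fin N) ℂ).det) →
        ((η g : ℂˣ) : ℂ) ^ 2 *
            ∏ v : {v : InfinitePlace F // v.IsReal},
              ((((archAt F E c N J (wOf v) (hw v) hc g : archLocal E N J (wOf v)) : GL (Fin N) ℂ) :
                Matrix (Fin N) (Fin N) ℂ).det)⁻¹ =
          ∏ v : {v : InfinitePlace F // v.IsReal},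
            ((χ.archComponent (wOf v).1 (QuadraticForms.ideleInfiniteComponent E (wOf v).1 u) : ℂˣ) : ℂ) ^ 2 := by
  -- the odd exponents, place by place (no CM theory)
  have hev : ∀ v : {v : InfinitePlace F // v.IsReal}, ∃ e : ℤ, Odd e ∧ ∀ y : ((wOf v).1.Completion)ˣ,
      ((χ.archComponent (wOf v).1 y : ℂˣ) : ℂ) =
        ((unitPart (Units.map (Completion.extensionEmbedding (wOf v).1).toMonoidHom y) : Circle) : ℂ) ^ e :=
    fun v => hχ.exists_odd_archComponent_eq_unitPart_zpow c (wOf v) hχu (hw v) hc hcδ hδ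
  choose e hodd he using hev
  obtain ⟨η, hη, hηc⟩ := exists_archDetZPow F E c N J hc wOf hw fun v => (e v + 1) / 2
  refine ⟨e, η, hodd, he, hη, hηc, fun g u hu => ?_⟩
  -- shorthand for the determinants
  set d : {v : InfinitePlace F // v.IsReal} → ℂ := fun v =>
    (((archAt F E c N J (wOf v) (hw v) hc g : archLocal E N J (wOf v)) : GL (Fin N) ℂ) : Matrix (Fin N) (Fin N) ℂ).det with hd
  have hd0 : ∀ v, d v ≠ 0 := fun v =>
    (Matrix.GeneralLinearGroup.det ((archAt F E c N J (wOf v) (hw v) hc g : archLocal E N J (wOf v)) : GL (Fin N) ℂ)).ne_zero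
  rw [hη g, ← Finset.prod_pow, ← Finset.prod_mul_distrib]
  refine Finset.prod_congr rfl fun v _ => ?_
  rw [he v, unitPart_zpow_sq, zpow_sq_mul_inv' (hd0 v), two_mul_add_one_ediv_two_sub_one' (hodd v)]
  exact congrArg (fun z : ℂ => z ^ e v) (hu v).symm

/-! ## §2 On the Siegel parabolic of the doubled unitary group: `u = det_Δ (g,1)` -/

section Doubled

variable {n : ℕ} (T : Matrix (Fin n) (Fin n) F) (hT : IsUnit T.det) (JD : Matrix (Fin (n + n)) (Fin (n + n)) E)
  (hJD : JD = (Matrix.reindex finSumFinEquiv finSumFinEquiv (Matrix.fromBlocks T 0 0 (-T))).map (algebraMap F E))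

omit [NumberField F] [NumberField E] [Algebra.IsQuadraticExtension F E] in
include hJD in
/-- `σ_w(J^𝔻) = e₂ (T_w ⊕ −T_w) e₂` with `T_w = σ_w(T)`. [cite: Kudla1994, §3] -/
theorem map_embedding_doubledGram (w : {w : InfinitePlace E // w.IsComplex}) :
    JD.map w.1.embedding =
      Matrix.reindex finSumFinEquiv finSumFinEquiv
        (Matrix.fromBlocks (T.map ((w.1.embedding).comp (algebraMap F E))) 0 0 (-T.map ((w.1.embedding).comp (algebraMap F E)))) := by
  subst hJD
  rw [Matrix.map_map, ← RingHom.coe_comp]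
  simp only [Matrix.reindex_apply]
  rw [← Matrix.submatrix_map, Matrix.fromBlocks_map, Matrix.map_zero _ (map_zero _), Matrix.map_neg _ (map_neg _)]

omit [NumberField F] [NumberField E] [Algebra.IsQuadraticExtension F E] in
include hT in
/-- `det σ_w(T)` is a unit. [cite: Kudla1994, §3] -/
theorem isUnit_det_map_embedding (w : {w : InfinitePlace E // w.IsComplex}) :
    IsUnit (T.map ((w.1.embedding).comp (algebraMap F E))).det := by
  have h := hT.map ((w.1.embedding).comp (algebraMap F E))
  rwa [RingHom.map_det, RingHom.mapMatrix_apply] at h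

omit [Algebra.IsQuadraticExtension F E] in
include hT hJD in
/-- **`det g_w · x(g_w)‾ = x(g_w)` on `P_Δ`** (general `E/F`, `c`-fixed complex `w`): for `g ∈ U(J^𝔻)(E ⊗ ℝ)` whose adelic matrix
satisfies the Siegel relation, the place component `g_w ∈ U(σ_w J^𝔻)(ℂ)` has `det g_w · conj x(g_w) = x(g_w)`, `x = det(·|_Δ)`
(the CM lemma of `DoubledUnitaryArchSiegelTwist`, re-typed). [cite: Kudla1994, §3] -/
theorem det_archAt_mul_conj_eq (g : arch F E c (n + n) JD)
    (hS : (Matrix.reindex finSumFinEquiv.symm finSumFinEquiv.symm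
            (((archToAdelic F E c (n + n) JD g).1 : GL (Fin (n + n)) (AdeleRing (𝓞 E) E)) :
              Matrix (Fin (n + n)) (Fin (n + n)) (AdeleRing (𝓞 E) E))).toBlocks₁₁ +
          (Matrix.reindex finSumFinEquiv.symm finSumFinEquiv.symm
            (((archToAdelic F E c (n + n) JD g).1 : GL (Fin (n + n)) (AdeleRing (𝓞 E) E)) :
              Matrix (Fin (n + n)) (Fin (n + n)) (AdeleRing (𝓞 E) E))).toBlocks₁₂ =
        (Matrix.reindex finSumFinEquiv.symm finSumFinEquiv.symm
            (((archToAdelic F E c (n + n) JD g).1 : GL (Fin (n + n)) (AdeleRing (𝓞 E) E)) :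
              Matrix (Fin (n + n)) (Fin (n + n)) (AdeleRing (𝓞 E) E))).toBlocks₂₁ +
          (Matrix.reindex finSumFinEquiv.symm finSumFinEquiv.symm
            (((archToAdelic F E c (n + n) JD g).1 : GL (Fin (n + n)) (AdeleRing (𝓞 E) E)) :
              Matrix (Fin (n + n)) (Fin (n + n)) (AdeleRing (𝓞 E) E))).toBlocks₂₂)
    (w : {w : InfinitePlace E // w.IsComplex}) (hww : c • w.1 = w.1) :
    (((archAt F E c (n + n) JD w hww hc g : archLocal E (n + n) JD w) : GL (Fin (n + n)) ℂ) :
        Matrix (Fin (n + n)) (Fin (n + n)) ℂ).det *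
      conj ((Matrix.reindex finSumFinEquiv.symm finSumFinEquiv.symm
              (((archAt F E c (n + n) JD w hww hc g : archLocal E (n + n) JD w) : GL (Fin (n + n)) ℂ) :
                Matrix (Fin (n + n)) (Fin (n + n)) ℂ)).toBlocks₁₁ +
            (Matrix.reindex finSumFinEquiv.symm finSumFinEquiv.symm
              (((archAt F E c (n + n) JD w hww hc g : archLocal E (n + n) JD w) : GL (Fin (n + n)) ℂ) :
                Matrix (Fin (n + n)) (Fin (n + n)) ℂ)).toBlocks₁₂).det =
      ((Matrix.reindex finSumFinEquiv.symm finSumFinEquiv.symm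
              (((archAt F E c (n + n) JD w hww hc g : archLocal E (n + n) JD w) : GL (Fin (n + n)) ℂ) :
                Matrix (Fin (n + n)) (Fin (n + n)) ℂ)).toBlocks₁₁ +
            (Matrix.reindex finSumFinEquiv.symm finSumFinEquiv.symm
              (((archAt F E c (n + n) JD w hww hc g : archLocal E (n + n) JD w) : GL (Fin (n + n)) ℂ) :
                Matrix (Fin (n + n)) (Fin (n + n)) ℂ)).toBlocks₁₂).det := by
  set gw : Matrix (Fin (n + n)) (Fin (n + n)) ℂ :=
    (((archAt F E c (n + n) JD w hww hc g : archLocal E (n + n) JD w) : GL (Fin (n + n)) ℂ) :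
      Matrix (Fin (n + n)) (Fin (n + n)) ℂ) with hgw
  set φ : AdeleRing (𝓞 E) E →+* ℂ := (Completion.extensionEmbedding w.1).comp
      ((Pi.evalRingHom (fun v : InfinitePlace E => v.Completion) w.1).comp (adeleFst E)) with hφ
  have hmap : (((archToAdelic F E c (n + n) JD g).1 : GL (Fin (n + n)) (AdeleRing (𝓞 E) E)) :
        Matrix (Fin (n + n)) (Fin (n + n)) (AdeleRing (𝓞 E) E)).map φ = gw :=
    map_placeEval_coe_archToAdelic F E c (n + n) JD w hww hc g
  have hmem := (mem_archLocal_iff E (n + n) JD w _).1 (archAt F E c (n + n) JD w hww hc g).2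
  rw [map_embedding_doubledGram F E T JD hJD w] at hmem
  have hSw : (Matrix.reindex finSumFinEquiv.symm finSumFinEquiv.symm gw).toBlocks₁₁ +
        (Matrix.reindex finSumFinEquiv.symm finSumFinEquiv.symm gw).toBlocks₁₂ =
      (Matrix.reindex finSumFinEquiv.symm finSumFinEquiv.symm gw).toBlocks₂₁ +
        (Matrix.reindex finSumFinEquiv.symm finSumFinEquiv.symm gw).toBlocks₂₂ := by
    have h := congrArg (fun X : Matrix (Fin n) (Fin n) (AdeleRing (𝓞 E) E) => X.map φ) hS
    simp only [Matrix.map_add φ (map_add φ)] at h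
    rw [← hmap]
    exact h
  exact det_mul_map_det_deltaBlock_reindex (σ := starRingEnd ℂ) finSumFinEquiv hmem hSw
    (isUnit_det_map_embedding F E T hT w) Complex.conj_conj

include hT hJD hc hcδ hδ hw in
/-- **THE ARCHIMEDEAN TWIST ON THE SIEGEL PARABOLIC, general `E/F`, type-(i) places.**  For `χ` unitary with `χ|_{𝕀_F} = ε_{E/F}`,
`T ∈ GL_n(F)`, `J^𝔻 = e₂(T ⊕ −T)e₂ ⊗ E`, and a family `v ↦ w(v)` of `c`-fixed complex places: the continuous character
`η = ∏_v det(g_{w(v)})^{(e_v+1)/2}` (`e_v` the odd exponents of `χ_{w(v)}`) satisfies, for every `g ∈ U(J^𝔻)(E ⊗ ℝ)` with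
`(g,1) ∈ P_Δ` and every idèle `u` equal to Kudla's `x((g,1)) = det((g,1)|_Δ)`,
`η(g)² · ∏_v det(g_{w(v)})⁻¹ = ∏_v χ_{w(v)}(u_{w(v)})²` — the type-(i) factor of `χ(u)²`
(`QuadExt.apply_eq_prod_archComponent_of_snd_eq_one` + `prod_infinitePlace_eq_prod_placesOver` give the rest).
[cite: Kudla1994, §3] [cite: Paul1998, §1.2 (1.2.1)–(1.2.2) p. 389 L11–29] -/
theorem _root_.Literature.RepresentationTheory.HarrisKudlaSweet1996.IsSplittingCharExt.exists_archDetTwist_doubled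
    {χ : HeckeCharacter E} (hχu : χ.IsUnitary) (hχ : IsSplittingCharExt F E 1 χ) :
    ∃ η : arch F E c (n + n) JD →* ℂˣ,
      (Continuous fun g => ((η g : ℂˣ) : ℂ)) ∧
      ∀ (g : arch F E c (n + n) JD) (u : ideleGroup E),
        (Matrix.reindex finSumFinEquiv.symm finSumFinEquiv.symm
              (((archToAdelic F E c (n + n) JD g).1 : GL (Fin (n + n)) (AdeleRing (𝓞 E) E)) :
                Matrix (Fin (n + n)) (Fin (n + n)) (AdeleRing (𝓞 E) E))).toBlocks₁₁ +
            (Matrix.reindex finSumFinEquiv.symm finSumFinEquiv.symm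
              (((archToAdelic F E c (n + n) JD g).1 : GL (Fin (n + n)) (AdeleRing (𝓞 E) E)) :
                Matrix (Fin (n + n)) (Fin (n + n)) (AdeleRing (𝓞 E) E))).toBlocks₁₂ =
          (Matrix.reindex finSumFinEquiv.symm finSumFinEquiv.symm
              (((archToAdelic F E c (n + n) JD g).1 : GL (Fin (n + n)) (AdeleRing (𝓞 E) E)) :
                Matrix (Fin (n + n)) (Fin (n + n)) (AdeleRing (𝓞 E) E))).toBlocks₂₁ +
            (Matrix.reindex finSumFinEquiv.symm finSumFinEquiv.symm
              (((archToAdelic F E c (n + n) JD g).1 : GL (Fin (n + n)) (AdeleRing (𝓞 E) E)) :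
                Matrix (Fin (n + n)) (Fin (n + n)) (AdeleRing (𝓞 E) E))).toBlocks₂₂ →
        ((u : ideleGroup E) : AdeleRing (𝓞 E) E) =
          ((Matrix.reindex finSumFinEquiv.symm finSumFinEquiv.symm
              (((archToAdelic F E c (n + n) JD g).1 : GL (Fin (n + n)) (AdeleRing (𝓞 E) E)) :
                Matrix (Fin (n + n)) (Fin (n + n)) (AdeleRing (𝓞 E) E))).toBlocks₁₁ +
            (Matrix.reindex finSumFinEquiv.symm finSumFinEquiv.symm
              (((archToAdelic F E c (n + n) JD g).1 : GL (Fin (n + n)) (AdeleRing (𝓞 E) E)) :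
                Matrix (Fin (n + n)) (Fin (n + n)) (AdeleRing (𝓞 E) E))).toBlocks₁₂).det →
        ((η g : ℂˣ) : ℂ) ^ 2 *
            ∏ v : {v : InfinitePlace F // v.IsReal},
              ((((archAt F E c (n + n) JD (wOf v) (hw v) hc g : archLocal E (n + n) JD (wOf v)) : GL (Fin (n + n)) ℂ) :
                Matrix (Fin (n + n)) (Fin (n + n)) ℂ).det)⁻¹ =
          ∏ v : {v : InfinitePlace F // v.IsReal},
            ((χ.archComponent (wOf v).1 (QuadraticForms.ideleInfiniteComponent E (wOf v).1 u) : ℂˣ) : ℂ) ^ 2 := by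
  obtain ⟨e, η, -, -, -, hηc, hη⟩ := hχ.exists_archDetTwist F E c JD hc hcδ hδ wOf hw hχu
  refine ⟨η, hηc, fun g u hS hu => hη g u fun v => ?_⟩
  -- at `w = wOf v`: `σ_w(u_w) = x(g_w)` and `det g_w · conj x(g_w) = x(g_w)`
  set M : Matrix (Fin (n + n)) (Fin (n + n)) (AdeleRing (𝓞 E) E) :=
    (((archToAdelic F E c (n + n) JD g).1 : GL (Fin (n + n)) (AdeleRing (𝓞 E) E)) :
      Matrix (Fin (n + n)) (Fin (n + n)) (AdeleRing (𝓞 E) E)) with hM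
  have hφ : Completion.extensionEmbedding (wOf v).1 (((u : ideleGroup E) : AdeleRing (𝓞 E) E).1 (wOf v).1) =
      ((Matrix.reindex finSumFinEquiv.symm finSumFinEquiv.symm
          (((archAt F E c (n + n) JD (wOf v) (hw v) hc g : archLocal E (n + n) JD (wOf v)) : GL (Fin (n + n)) ℂ) :
            Matrix (Fin (n + n)) (Fin (n + n)) ℂ)).toBlocks₁₁ +
        (Matrix.reindex finSumFinEquiv.symm finSumFinEquiv.symm
          (((archAt F E c (n + n) JD (wOf v) (hw v) hc g : archLocal E (n + n) JD (wOf v)) : GL (Fin (n + n)) ℂ) :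
            Matrix (Fin (n + n)) (Fin (n + n)) ℂ)).toBlocks₁₂).det := by
    have h := map_det_deltaBlock_finSum ((Completion.extensionEmbedding (wOf v).1).comp
      ((Pi.evalRingHom (fun v : InfinitePlace E => v.Completion) (wOf v).1).comp (adeleFst E))) M
    rw [hM, map_placeEval_coe_archToAdelic F E c (n + n) JD (wOf v) (hw v) hc g] at h
    rw [← h, hu]
    rfl
  have hne : Completion.extensionEmbedding (wOf v).1 (((u : ideleGroup E) : AdeleRing (𝓞 E) E).1 (wOf v).1) ≠ 0 := by
    refine (map_ne_zero (Completion.extensionEmbedding (wOf v).1)).2 ?_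
    exact (QuadraticForms.ideleInfiniteComponent E (wOf v).1 u).ne_zero
  have hdet := det_archAt_mul_conj_eq F E c hc T hT JD hJD g hS (wOf v) (hw v)
  rw [← hφ] at hdet
  rw [eq_comm, eq_div_iff ((map_ne_zero (starRingEnd ℂ)).2 hne)]
  exact hdet

end Doubled

end Literature.NumberTheory.GelbartRogawski1991.UnitaryDualPair.ArchSplitting.QuadExt

end
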